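import Summits.QuantumFields.BalabanUV.Gaps.CapBlockTransferFloors
import Summits.QuantumFields.BalabanUV.Gaps.CapTailSigns

/-!
# Gaps / CapBlockTowerWashout — EARLY COEFFICIENTS OF ANY SIGN ARE WASHED OUT ALONG THE BLOCK TOWER `L₀ⁿ`
# (cell pub-balaban-gaps, seat g1-p3 gen 5, CAP+tail «split ∕ weakening» charge; companion of `CapBlockTowerEmpty` (same gen: with a rate
# from `k = 0` the CAP empties from an explicit power on) — here the rate is owed only EVENTUALLY (`Beta.RateCertificate.EvGeomRate`, from a
# threshold scale `k₁`), and NOTHING is assumed about the early coefficients `b_0, …, b_{k₁−1}`)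

HONEST FRAMING (cell rule, page 1 of everything): bookkeeping over hypothesis SHAPES of the tree's β sub-cell; NOTHING of Bałaban's is asserted
beyond print; [Balaban1987RG1] Thm 2 is UNPROVED IN PRINT and enters only as the conclusion `B12.Thm2Printed C L`; the eventual rate constants
`β⁰_∞, c₀, θ, k₁` at the small block size are HYPOTHESES (rows NE4 ∕ G-an2-4 — OPEN); the ONE-LOOP composition hypothesis `hblock : S.β0 k = blockSum n b k`
(Q-asym1-5, composition at one-loop order only) is a BINDER, never asserted; (D4) enters as `EverySlope` ∕ `LimitForm` for the `L₀ⁿ`-construction; NO coefficient of Bałaban's β⁰ is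
certified at any block size; 0∕6 binders discharged; one finite T⁴; NOT `BetaPertH`, NOT the continuum limit, NOT Clay.  HONEST DEPENDENCY (b2b
cell, verbatim): «continuum YM on T⁴ ⇐ BetaPertH ∧ nine spine estimates (0/9 proved); BetaPertH ⇐ (D1) ∧ (D4) ∧ CAP+tail; G-an2-4 gates asym,
D1 and NE2/3/4.»

THE POINT ([folklore] sequence algebra).  With `EvGeomRate b β⁰_∞ c₀ θ k₁` (`|b_k − β⁰_∞| ≤ c₀θ^k` for `k ≥ k₁` only; `0 ≤ c₀`, `0 ≤ θ < 1`)
and `E := Σ_{i<k₁} b_i` the EARLY SUM (any sign, any size), for every power `n ≥ k₁`: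
  `blockSum n b 0 ≥ E + (n − k₁)·β⁰_∞ − c₀θ^{k₁}∕(1−θ)`  and  `blockSum n b k ≥ n·β⁰_∞ − c₀θ^{k₁}∕(1−θ)` (`k ≥ 1`),
so the WASHOUT FLOOR `min(E, k₁β⁰_∞) + (n − k₁)·β⁰_∞ − c₀θ^{k₁}∕(1−θ)` lies below every block sum (§2) and is positive for
`n ≥ k₁ + ⌊(c₀θ^{k₁}∕(1−θ) − min(E, k₁β⁰_∞))∕β⁰_∞⌋₊ + 1` as soon as `0 < β⁰_∞` (§3, `blockSums_washout_of_index_le`; pure existence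
`exists_washoutPower`).  SHARP in the right sense (§4): the power MUST depend on the early sum — for every `n ≥ 1` some admissible early datum makes
the first block sum vanish (`early_datum_moves_threshold`) —, and a NEGATIVE early coefficient is compatible with all block sums positive from the
third power on (`negative_early_washed_out`: `b = (−1, 1, 1, …)`, `c₀ = 0`).  §5 ENDs under Q-asym1-5 for the `L₀ⁿ`-construction:
**`thm2Printed_of_blockTowerWashout_everySlope`** (eventual small-block rate + `0 < β⁰_∞` + the explicit power + `hblock` + `EverySlope` + (C) +
(U) + forward generation ⟹ `B12.Thm2Printed C L'`; NO sign, NO size of any early coefficient enters except through the ONE number `min(E, k₁β⁰_∞)`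
in the power), `thm2Printed_of_blockTowerWashout_limitForm`.  §4b THE WEAKEST FORM: an EVENTUAL FLOOR `0 < f ≤ b_j` (`j ≥ k₁`) — what END grade
consumes at the small block (`CapTailFloors`), supplied by any tail socket or by mere convergence to a positive limit — already gives all block
sums positive from the power `k₁ + ⌊(−min(E, k₁f))∕f⌋₊ + 1` on (`blockSums_of_eventualFloor_index_le`, `exists_towerPower_of_eventualFloor`;
ENDs `thm2Printed_of_blockTowerEventualFloor_everySlope` ∕ `_limitForm`): on the Q-asym1-5 road THEOREM-2 grade at a high power costs what END
grade costs at the small block, plus one number `E`; and MERE CONVERGENCE to a positive limit gives the EXISTENCE of a CAP-free power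
(`exists_towerPower_of_tendsto`).
READING for row CAP-k and the (M)∕CA-1 decision: a certified NEGATIVE early coefficient at a small block size `L₀` refutes (0.31) for the
`L₀`-construction (`CapNegSocketOnePoint`, given one-point continuity) but, on the Q-asym1-5 road, NOT for the `L₀ⁿ`-constructions from an
explicit power on; conversely no early sign computation at `L₀` is needed for those — a crude LOWER BOUND on the early sum `E` and the TAIL
(row G-an2-4) fix the power.  Nothing here lowers the price of Q-asym1-5 or of (D4) at the big block size.  0 sorry; 0 def; imports tree files only.

CITATION HEADER (tags CONTEXT ONLY).  [I] = T. Bałaban, Commun. Math. Phys. **109** (1987) [Balaban1987RG1]: Thm 2 p. 259 with (0.31); p. 251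
(«L odd > 11»); (1.22) p. 264; (2.12)–(2.14) p. 268.
-/

namespace Summit.QuantumFields.BalabanUV.Gaps.CapBlockTowerWashout

open Literature.MathematicalPhysics.QuantumFieldTheory.Balaban1983to89
open Literature.MathematicalPhysics.QuantumFieldTheory.Balaban1983to89.FlowStep
open Literature.MathematicalPhysics.QuantumFieldTheory.Balaban1983to89.FlowStepRuns
open Literature.MathematicalPhysics.QuantumFieldTheory.Balaban1983to89.DagBinding
open Literature.MathematicalPhysics.QuantumFieldTheory.Balaban1983to89.Beta.RateCertificate (GeomRate EvGeomRate blockSum)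
open Summit.QuantumFields.BalabanUV.Gaps.CapSignsConstRoad (EverySlope thm2Printed_of_beta0Floor_everySlope betaAFH_of_beta0Floor_everySlope)
open Finset

noncomputable section

/-! ## §1 The first block sum splits into the early sum and a tail sum -/

/-- `blockSum n b 0 = Σ_{i<n} b_i`. [folklore] -/
theorem blockSum_zero (n : ℕ) (b : ℕ → ℝ) : blockSum n b 0 = ∑ i ∈ range n, b i := by
  simp [blockSum]

/-- Early ∕ tail split of the first block sum for `k₁ ≤ n`: `blockSum n b 0 = Σ_{i<k₁} b_i + Σ_{k₁ ≤ i < n} b_i`. [folklore] -/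
theorem blockSum_zero_split {k₁ n : ℕ} (hn : k₁ ≤ n) (b : ℕ → ℝ) :
    blockSum n b 0 = ∑ i ∈ range k₁, b i + ∑ i ∈ Ico k₁ n, b i := by
  rw [blockSum_zero, range_eq_Ico, range_eq_Ico, Finset.sum_Ico_consecutive _ (Nat.zero_le k₁) hn]

/-! ## §2 Lower envelopes under an EVENTUAL rate -/

/-- Tail geometric bound: `0 ≤ c₀`, `0 ≤ θ < 1` ⟹ `c₀·Σ_{k₁ ≤ i < n} θ^i ≤ c₀θ^{k₁}∕(1−θ)`. [folklore] -/
theorem tail_geom_le {c₀ θ : ℝ} (hc₀ : 0 ≤ c₀) (hθ0 : 0 ≤ θ) (hθ1 : θ < 1) (k₁ n : ℕ) :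
    c₀ * ∑ i ∈ Ico k₁ n, θ ^ i ≤ c₀ * θ ^ k₁ / (1 - θ) := by
  calc c₀ * ∑ i ∈ Ico k₁ n, θ ^ i ≤ c₀ * (θ ^ k₁ / (1 - θ)) := mul_le_mul_of_nonneg_left (geom_sum_Ico_le_of_lt_one hθ0 hθ1) hc₀
    _ = c₀ * θ ^ k₁ / (1 - θ) := by ring

/-- **Tail sum envelope**: `EvGeomRate b β⁰_∞ c₀ θ k₁`, `0 ≤ c₀`, `0 ≤ θ < 1` ⟹ `(n − k₁)·β⁰_∞ − c₀θ^{k₁}∕(1−θ) ≤ Σ_{k₁ ≤ i < n} b_i` (`k₁ ≤ n`).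
[folklore] -/
theorem tailSum_ge {b : ℕ → ℝ} {binf c₀ θ : ℝ} {k₁ : ℕ} (hev : EvGeomRate b binf c₀ θ k₁) (hc₀ : 0 ≤ c₀) (hθ0 : 0 ≤ θ)
    (hθ1 : θ < 1) {n : ℕ} (hn : k₁ ≤ n) :
    ((n : ℝ) - k₁) * binf - c₀ * θ ^ k₁ / (1 - θ) ≤ ∑ i ∈ Ico k₁ n, b i := by
  have h1 : ∑ i ∈ Ico k₁ n, (binf - c₀ * θ ^ i) ≤ ∑ i ∈ Ico k₁ n, b i :=
    sum_le_sum fun i hi => by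
      have := (abs_le.mp (hev i (mem_Ico.mp hi).1)).1
      linarith
  have h2 : ∑ i ∈ Ico k₁ n, (binf - c₀ * θ ^ i) = ((n : ℝ) - k₁) * binf - c₀ * ∑ i ∈ Ico k₁ n, θ ^ i := by
    rw [sum_sub_distrib, sum_const, Nat.card_Ico, nsmul_eq_mul, mul_sum, Nat.cast_sub hn]
  have h3 := tail_geom_le hc₀ hθ0 hθ1 k₁ n
  linarith

/-- **First block sum**: `blockSum n b 0 ≥ E + (n − k₁)·β⁰_∞ − c₀θ^{k₁}∕(1−θ)` with `E = Σ_{i<k₁} b_i` the early sum (ANY sign), `k₁ ≤ n`.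
[folklore] -/
theorem blockSum_zero_ge {b : ℕ → ℝ} {binf c₀ θ : ℝ} {k₁ : ℕ} (hev : EvGeomRate b binf c₀ θ k₁) (hc₀ : 0 ≤ c₀)
    (hθ0 : 0 ≤ θ) (hθ1 : θ < 1) {n : ℕ} (hn : k₁ ≤ n) :
    (∑ i ∈ range k₁, b i) + ((n : ℝ) - k₁) * binf - c₀ * θ ^ k₁ / (1 - θ) ≤ blockSum n b 0 := by
  rw [blockSum_zero_split hn]
  have := tailSum_ge hev hc₀ hθ0 hθ1 hn
  linarith

/-- **Later block sums** (`1 ≤ k`, `k₁ ≤ n`): all indices `nk + i ≥ k₁` lie in the rate region and `θ^{nk} ≤ θ^{k₁}`, so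
`blockSum n b k ≥ n·β⁰_∞ − c₀θ^{k₁}∕(1−θ)`. [folklore] -/
theorem blockSum_succ_ge {b : ℕ → ℝ} {binf c₀ θ : ℝ} {k₁ : ℕ} (hev : EvGeomRate b binf c₀ θ k₁) (hc₀ : 0 ≤ c₀)
    (hθ0 : 0 ≤ θ) (hθ1 : θ < 1) {n : ℕ} (hn : k₁ ≤ n) {k : ℕ} (hk : 1 ≤ k) :
    (n : ℝ) * binf - c₀ * θ ^ k₁ / (1 - θ) ≤ blockSum n b k := by
  have hnk : k₁ ≤ n * k := hn.trans (Nat.le_mul_of_pos_right n hk)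
  have h1 : ∑ i ∈ range n, (binf - c₀ * θ ^ k₁ * θ ^ i) ≤ blockSum n b k := by
    unfold blockSum
    refine sum_le_sum fun i _ => ?_
    have hr := (abs_le.mp (hev (n * k + i) (hnk.trans (Nat.le_add_right _ _)))).1
    have hθpow : c₀ * θ ^ (n * k + i) ≤ c₀ * θ ^ k₁ * θ ^ i := by
      rw [pow_add, ← mul_assoc]
      exact mul_le_mul_of_nonneg_right (mul_le_mul_of_nonneg_left (pow_le_pow_of_le_one hθ0 hθ1.le hnk) hc₀) (pow_nonneg hθ0 i)
    linarith
  have h2 : ∑ i ∈ range n, (binf - c₀ * θ ^ k₁ * θ ^ i) = (n : ℝ) * binf - c₀ * θ ^ k₁ * ∑ i ∈ range n, θ ^ i := by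
    rw [sum_sub_distrib, sum_const, card_range, nsmul_eq_mul, mul_sum]
  have h3 : c₀ * θ ^ k₁ * ∑ i ∈ range n, θ ^ i ≤ c₀ * θ ^ k₁ / (1 - θ) := by
    have hg : ∑ i ∈ range n, θ ^ i ≤ θ ^ 0 / (1 - θ) := by
      rw [range_eq_Ico]; exact geom_sum_Ico_le_of_lt_one hθ0 hθ1
    calc c₀ * θ ^ k₁ * ∑ i ∈ range n, θ ^ i ≤ c₀ * θ ^ k₁ * (θ ^ 0 / (1 - θ)) :=
          mul_le_mul_of_nonneg_left hg (mul_nonneg hc₀ (pow_nonneg hθ0 k₁))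
      _ = c₀ * θ ^ k₁ / (1 - θ) := by rw [pow_zero]; ring
  linarith

/-- **THE WASHOUT FLOOR** (`k₁ ≤ n`): `min(E, k₁β⁰_∞) + (n − k₁)·β⁰_∞ − c₀θ^{k₁}∕(1−θ) ≤ blockSum n b k` for EVERY `k`. [folklore] -/
theorem blockSum_ge_washoutFloor {b : ℕ → ℝ} {binf c₀ θ : ℝ} {k₁ : ℕ} (hev : EvGeomRate b binf c₀ θ k₁) (hc₀ : 0 ≤ c₀)
    (hθ0 : 0 ≤ θ) (hθ1 : θ < 1) {n : ℕ} (hn : k₁ ≤ n) (k : ℕ) :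
    min (∑ i ∈ range k₁, b i) ((k₁ : ℝ) * binf) + ((n : ℝ) - k₁) * binf - c₀ * θ ^ k₁ / (1 - θ) ≤ blockSum n b k := by
  rcases Nat.eq_zero_or_pos k with rfl | hk
  · have h1 := blockSum_zero_ge hev hc₀ hθ0 hθ1 hn
    have h2 := min_le_left (∑ i ∈ range k₁, b i) ((k₁ : ℝ) * binf)
    linarith
  · have h1 := blockSum_succ_ge hev hc₀ hθ0 hθ1 hn hk
    have h2 := min_le_right (∑ i ∈ range k₁, b i) ((k₁ : ℝ) * binf)
    have e : (n : ℝ) * binf = (k₁ : ℝ) * binf + ((n : ℝ) - k₁) * binf := by ring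
    linarith

/-! ## §3 Positivity from an explicit power; pure existence -/

/-- The explicit power beats the deficit: `0 < β⁰_∞`, `n ≥ k₁ + ⌊D∕β⁰_∞⌋₊ + 1` ⟹ `D < (n − k₁)·β⁰_∞` (any real `D`). [folklore] -/
theorem deficit_lt_of_index_le {binf D : ℝ} (hbinf : 0 < binf) {k₁ n : ℕ} (hn : k₁ + ⌊D / binf⌋₊ + 1 ≤ n) :
    D < ((n : ℝ) - k₁) * binf := by
  have h1 : D / binf < (⌊D / binf⌋₊ : ℝ) + 1 := Nat.lt_floor_add_one _
  have h2 : ((⌊D / binf⌋₊ : ℝ) + 1) ≤ (n : ℝ) - k₁ := by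
    have : ((k₁ + ⌊D / binf⌋₊ + 1 : ℕ) : ℝ) ≤ (n : ℝ) := by exact_mod_cast hn
    push_cast at this
    linarith
  have h3 : D / binf < (n : ℝ) - k₁ := h1.trans_le h2
  rwa [div_lt_iff₀ hbinf] at h3

/-- **WASHOUT**: `EvGeomRate b β⁰_∞ c₀ θ k₁` (`0 ≤ c₀`, `0 ≤ θ < 1`), `0 < β⁰_∞`, and the explicit power
`n ≥ k₁ + ⌊(c₀θ^{k₁}∕(1−θ) − min(E, k₁β⁰_∞))∕β⁰_∞⌋₊ + 1` (`E = Σ_{i<k₁} b_i`) ⟹ the washout floor is POSITIVE and below every block sum: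
ALL block sums at power `n` are positive, whatever the signs and sizes of `b_0, …, b_{k₁−1}`. [folklore] -/
theorem blockSums_washout_of_index_le {b : ℕ → ℝ} {binf c₀ θ : ℝ} {k₁ : ℕ} (hev : EvGeomRate b binf c₀ θ k₁) (hc₀ : 0 ≤ c₀)
    (hθ0 : 0 ≤ θ) (hθ1 : θ < 1) (hbinf : 0 < binf) {n : ℕ}
    (hn : k₁ + ⌊(c₀ * θ ^ k₁ / (1 - θ) - min (∑ i ∈ range k₁, b i) ((k₁ : ℝ) * binf)) / binf⌋₊ + 1 ≤ n) :
    0 < min (∑ i ∈ range k₁, b i) ((k₁ : ℝ) * binf) + ((n : ℝ) - k₁) * binf - c₀ * θ ^ k₁ / (1 - θ) ∧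
      ∀ k, min (∑ i ∈ range k₁, b i) ((k₁ : ℝ) * binf) + ((n : ℝ) - k₁) * binf - c₀ * θ ^ k₁ / (1 - θ) ≤ blockSum n b k := by
  have hk₁n : k₁ ≤ n := le_trans (Nat.le_add_right k₁ _) (le_trans (Nat.le_add_right _ 1) hn)
  have hD := deficit_lt_of_index_le hbinf hn
  exact ⟨by linarith, blockSum_ge_washoutFloor hev hc₀ hθ0 hθ1 hk₁n⟩

/-- All block sums positive from the explicit power on. [folklore] -/
theorem blockSums_pos_of_washoutIndex_le {b : ℕ → ℝ} {binf c₀ θ : ℝ} {k₁ : ℕ} (hev : EvGeomRate b binf c₀ θ k₁)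
    (hc₀ : 0 ≤ c₀) (hθ0 : 0 ≤ θ) (hθ1 : θ < 1) (hbinf : 0 < binf) {n : ℕ}
    (hn : k₁ + ⌊(c₀ * θ ^ k₁ / (1 - θ) - min (∑ i ∈ range k₁, b i) ((k₁ : ℝ) * binf)) / binf⌋₊ + 1 ≤ n) :
    ∀ k, 0 < blockSum n b k := fun k => by
  obtain ⟨hpos, hF⟩ := blockSums_washout_of_index_le hev hc₀ hθ0 hθ1 hbinf hn
  exact hpos.trans_le (hF k)

/-- **PURE EXISTENCE** (no early information at all): an eventual rate with a positive limit ⟹ SOME power `n₁` from which on all block sums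
are positive.  (`n₁` is explicit only through the early sum.) [folklore] -/
theorem exists_washoutPower {b : ℕ → ℝ} {binf c₀ θ : ℝ} {k₁ : ℕ} (hev : EvGeomRate b binf c₀ θ k₁) (hc₀ : 0 ≤ c₀)
    (hθ0 : 0 ≤ θ) (hθ1 : θ < 1) (hbinf : 0 < binf) : ∃ n₁ : ℕ, ∀ n, n₁ ≤ n → ∀ k, 0 < blockSum n b k :=
  ⟨_, fun _ hn => blockSums_pos_of_washoutIndex_le hev hc₀ hθ0 hθ1 hbinf hn⟩

/-- A rate from `k = 0` is the case `k₁ = 0` (`E = 0`, `min(0,0) = 0`): power `⌊(c₀∕(1−θ))∕β⁰_∞⌋₊ + 1`, as in `CapBlockTowerEmpty`. [folklore] -/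
theorem blockSums_pos_of_geomRate_index_le {b : ℕ → ℝ} {binf c₀ θ : ℝ} (hconv : GeomRate b binf c₀ θ) (hθ0 : 0 ≤ θ)
    (hθ1 : θ < 1) (hbinf : 0 < binf) {n : ℕ} (hn : ⌊(c₀ / (1 - θ)) / binf⌋₊ + 1 ≤ n) : ∀ k, 0 < blockSum n b k := by
  have hev : EvGeomRate b binf c₀ θ 0 := fun k _ => hconv k
  refine blockSums_pos_of_washoutIndex_le hev hconv.const_nonneg hθ0 hθ1 hbinf ?_
  simpa using hn

/-! ## §4 Sharpness: the power depends on the early datum; a negative early coefficient is washed out -/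

/-- **THE POWER MUST DEPEND ON THE EARLY DATUM**: for every `n ≥ 1` and all constants there is a sequence with an exact rate from `k₁ = 1`
(`b_k = β⁰_∞` for `k ≥ 1`, `c₀ = 0`) whose FIRST block sum at power `n` VANISHES (`b_0 := −(n−1)·β⁰_∞`).  So no power is CAP-free uniformly
in the early coefficients — the washout index carries `min(E, k₁β⁰_∞)` by necessity. [folklore] -/
theorem early_datum_moves_threshold (binf θ : ℝ) {n : ℕ} (hn : 1 ≤ n) :
    ∃ b : ℕ → ℝ, EvGeomRate b binf 0 θ 1 ∧ blockSum n b 0 = 0 := by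
  refine ⟨fun k => if k = 0 then -(((n : ℝ) - 1) * binf) else binf, fun k hk => ?_, ?_⟩
  · have hk0 : k ≠ 0 := by omega
    simp [hk0]
  · rw [blockSum_zero_split hn, sum_range_one, if_pos rfl]
    have : ∑ i ∈ Ico 1 n, (if i = 0 then -(((n : ℝ) - 1) * binf) else binf) = ∑ _i ∈ Ico 1 n, binf :=
      sum_congr rfl fun i hi => if_neg (by have := (mem_Ico.mp hi).1; omega)
    rw [this, sum_const, Nat.card_Ico, nsmul_eq_mul, Nat.cast_sub hn, Nat.cast_one]
    ring

/-- **A NEGATIVE EARLY COEFFICIENT IS WASHED OUT**: `b = (−1, 1, 1, 1, …)` has `b_0 < 0` (so every road through the sign of the first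
coefficient FAILS at power `1`: `blockSum 1 b 0 = −1`, and `blockSum 2 b 0 = 0`), carries the exact eventual rate `EvGeomRate b 1 0 θ 1`, and
ALL its block sums at every power `n ≥ 3` are positive (`blockSum n b 0 = n − 2`, `blockSum n b k = n` for `k ≥ 1`). [folklore] -/
theorem negative_early_washed_out (θ : ℝ) :
    let b : ℕ → ℝ := fun k => if k = 0 then -1 else 1
    b 0 < 0 ∧ EvGeomRate b 1 0 θ 1 ∧ blockSum 1 b 0 = -1 ∧ blockSum 2 b 0 = 0 ∧
      ∀ n : ℕ, 3 ≤ n → ∀ k, 0 < blockSum n b k := by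
  intro b
  have hb : ∀ k, k ≠ 0 → b k = 1 := fun k hk => if_neg hk
  refine ⟨by simp [b], fun k hk => by simp [b, show k ≠ 0 by omega], by simp [blockSum, b],
    by simp [blockSum, b, sum_range_succ], fun n hn k => ?_⟩
  rcases Nat.eq_zero_or_pos k with rfl | hk
  · rw [blockSum_zero_split (show 1 ≤ n by omega), sum_range_one]
    have : ∑ i ∈ Ico 1 n, b i = ∑ _i ∈ Ico 1 n, (1 : ℝ) :=
      sum_congr rfl fun i hi => hb i (by have := (mem_Ico.mp hi).1; omega)
    rw [this, sum_const, Nat.card_Ico, nsmul_eq_mul, mul_one, Nat.cast_sub (by omega : 1 ≤ n), Nat.cast_one]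
    simp only [b, if_pos rfl]
    have : (3 : ℝ) ≤ (n : ℝ) := by exact_mod_cast hn
    linarith
  · unfold blockSum
    refine sum_pos (fun i _ => ?_) ⟨0, mem_range.mpr (by omega)⟩
    rw [hb _ (by have : 1 ≤ n * k := Nat.le_mul_of_pos_right n hk |>.trans' (by omega); omega)]
    exact one_pos

/-! ## §4b THE WEAKEST FORM: an EVENTUAL FLOOR at the small block suffices (no rate, no limit) -/

/-- First block sum from an eventual floor `f ≤ b_j` (`j ≥ k₁`), `k₁ ≤ n`: `E + (n − k₁)·f ≤ blockSum n b 0`. [folklore] -/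
theorem blockSum_zero_ge_of_eventualFloor {b : ℕ → ℝ} {f : ℝ} {k₁ : ℕ} (hF : ∀ j, k₁ ≤ j → f ≤ b j) {n : ℕ}
    (hn : k₁ ≤ n) : (∑ i ∈ range k₁, b i) + ((n : ℝ) - k₁) * f ≤ blockSum n b 0 := by
  rw [blockSum_zero_split hn]
  have h1 : ∑ _i ∈ Ico k₁ n, f ≤ ∑ i ∈ Ico k₁ n, b i := sum_le_sum fun i hi => hF i (mem_Ico.mp hi).1
  rw [sum_const, Nat.card_Ico, nsmul_eq_mul, Nat.cast_sub hn] at h1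
  linarith

/-- Later block sums from an eventual floor (`1 ≤ k`, `k₁ ≤ n`): `n·f ≤ blockSum n b k`. [folklore] -/
theorem blockSum_succ_ge_of_eventualFloor {b : ℕ → ℝ} {f : ℝ} {k₁ : ℕ} (hF : ∀ j, k₁ ≤ j → f ≤ b j) {n : ℕ}
    (hn : k₁ ≤ n) {k : ℕ} (hk : 1 ≤ k) : (n : ℝ) * f ≤ blockSum n b k := by
  have hnk : k₁ ≤ n * k := hn.trans (Nat.le_mul_of_pos_right n hk)
  unfold blockSum
  calc (n : ℝ) * f = ∑ _i ∈ range n, f := by simp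
    _ ≤ ∑ i ∈ range n, b (n * k + i) := sum_le_sum fun i _ => hF _ (hnk.trans (Nat.le_add_right _ _))

/-- **THE WEAKEST TOWER ROAD — AN EVENTUAL FLOOR IS ALL THE TAIL MUST GIVE**: `0 < f ≤ b_j` for `j ≥ k₁` (what END-grade statements
consume at the small block: `CapTailFloors`; supplied by ANY tail socket of the tree or by mere convergence to a positive limit,
`CapTailLimitNecessary.eventualFloor_of_thm2Printed_tendsto` ∕ `CapTailFloors`), early coefficients of ANY sign with early sum `E = Σ_{i<k₁} b_i`,
and the power `n ≥ k₁ + ⌊(−min(E, k₁f))∕f⌋₊ + 1` ⟹ the floor `min(E, k₁f) + (n − k₁)·f` is positive and below EVERY block sum.  So on the Q-asym1-5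
road THEOREM-2 grade (every `k`) at a high enough power costs exactly what END grade costs at the small block, plus ONE number (`E`). [folklore] -/
theorem blockSums_of_eventualFloor_index_le {b : ℕ → ℝ} {f : ℝ} {k₁ : ℕ} (hf : 0 < f) (hF : ∀ j, k₁ ≤ j → f ≤ b j) {n : ℕ}
    (hn : k₁ + ⌊(-min (∑ i ∈ range k₁, b i) ((k₁ : ℝ) * f)) / f⌋₊ + 1 ≤ n) :
    0 < min (∑ i ∈ range k₁, b i) ((k₁ : ℝ) * f) + ((n : ℝ) - k₁) * f ∧
      ∀ k, min (∑ i ∈ range k₁, b i) ((k₁ : ℝ) * f) + ((n : ℝ) - k₁) * f ≤ blockSum n b k := by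
  have hk₁n : k₁ ≤ n := le_trans (Nat.le_add_right k₁ _) (le_trans (Nat.le_add_right _ 1) hn)
  have hD := deficit_lt_of_index_le hf hn
  refine ⟨by linarith, fun k => ?_⟩
  rcases Nat.eq_zero_or_pos k with rfl | hk
  · have h1 := blockSum_zero_ge_of_eventualFloor hF hk₁n
    have h2 := min_le_left (∑ i ∈ range k₁, b i) ((k₁ : ℝ) * f)
    linarith
  · have h1 := blockSum_succ_ge_of_eventualFloor hF hk₁n hk
    have h2 := min_le_right (∑ i ∈ range k₁, b i) ((k₁ : ℝ) * f)
    have e : (n : ℝ) * f = (k₁ : ℝ) * f + ((n : ℝ) - k₁) * f := by ring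
    linarith

/-- Pure existence: an eventual positive floor at the small block ⟹ some power from which on ALL block sums are positive. [folklore] -/
theorem exists_towerPower_of_eventualFloor {b : ℕ → ℝ} {f : ℝ} {k₁ : ℕ} (hf : 0 < f) (hF : ∀ j, k₁ ≤ j → f ≤ b j) :
    ∃ n₁ : ℕ, ∀ n, n₁ ≤ n → ∀ k, 0 < blockSum n b k :=
  ⟨_, fun _ hn k => by
    obtain ⟨hpos, hFl⟩ := blockSums_of_eventualFloor_index_le hf hF hn
    exact hpos.trans_le (hFl k)⟩

/-- **MERE CONVERGENCE TO A POSITIVE LIMIT at the small block suffices for the EXISTENCE of a CAP-free power** (no rate, no explicit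
index): `b_k → β⁰_∞ > 0` ⟹ `∃ n₁, ∀ n ≥ n₁, ∀ k, 0 < blockSum n b k` (eventual floor `β⁰_∞∕2` + §4b).  Compare the necessity side: under mere
convergence `0 < β⁰_∞` is NECESSARY for (0.31) (`CapTailLimitNecessary.thm2Printed_iff_allSigns_and_limit_pos`). [folklore] -/
theorem exists_towerPower_of_tendsto {b : ℕ → ℝ} {binf : ℝ} (hb : Filter.Tendsto b Filter.atTop (nhds binf)) (hbinf : 0 < binf) :
    ∃ n₁ : ℕ, ∀ n, n₁ ≤ n → ∀ k, 0 < blockSum n b k := by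
  obtain ⟨k₁, hk₁⟩ := Filter.eventually_atTop.mp (hb.eventually_const_lt (half_lt_self hbinf))
  exact exists_towerPower_of_eventualFloor (half_pos hbinf) (k₁ := k₁) fun j hj => (hk₁ j hj).le

/-! ## §5 ENDs for the `L₀ⁿ`-construction under Q-asym1-5 -/

variable {β : HBeta}

/-- **[Balaban1987RG1] THEOREM 2 AS PRINTED FOR THE `L₀ⁿ`-CONSTRUCTION, EARLY COEFFICIENTS WASHED OUT, every-slope road**: the DAG `C` of the
block-size-`L₀ⁿ` construction (forward generation), its split `S`; at the SMALL block size an EVENTUAL rate `EvGeomRate b β⁰_∞ c₀ θ k₁` (`0 ≤ c₀`,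
`0 ≤ θ < 1`) with `0 < β⁰_∞` and early coefficients `b_0, …, b_{k₁−1}` of ANY sign; the power
`n ≥ k₁ + ⌊(c₀θ^{k₁}∕(1−θ) − min(Σ_{i<k₁} b_i, k₁β⁰_∞))∕β⁰_∞⌋₊ + 1`; the one-loop composition hypothesis `hblock` (Q-asym1-5, a binder); `EverySlope S γc` ((D4) currency), (C),
(U) ⟹ `B12.Thm2Printed C L'` for every log-unit `L' > 1` (`CapSignsConstRoad.thm2Printed_of_beta0Floor_everySlope` on the washout floor).
[cite: Balaban1987RG1, Thm 2 p.259 with (0.31) and (1.22) p.264] -/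
theorem thm2Printed_of_blockTowerWashout_everySlope {C : B12.Construction} (hgen : ForwardGenerated C β) {L' : ℝ} (hL : 1 < L')
    (S : B12Beta.OneLoopSplit β) {b : ℕ → ℝ} {n : ℕ} (hblock : ∀ k, S.β0 k = blockSum n b k) {binf c₀ θ γc β' : ℝ} {k₁ : ℕ}
    (hev : EvGeomRate b binf c₀ θ k₁) (hc₀ : 0 ≤ c₀) (hθ0 : 0 ≤ θ) (hθ1 : θ < 1) (hbinf : 0 < binf)
    (hn : k₁ + ⌊(c₀ * θ ^ k₁ / (1 - θ) - min (∑ i ∈ range k₁, b i) ((k₁ : ℝ) * binf)) / binf⌋₊ + 1 ≤ n)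
    (hrem : EverySlope S γc) (hcont : BetaContH γc β) (hup : BetaUpperH β' γc β) : B12.Thm2Printed C L' := by
  obtain ⟨hpos, hF⟩ := blockSums_washout_of_index_le hev hc₀ hθ0 hθ1 hbinf hn
  exact thm2Printed_of_beta0Floor_everySlope hgen hL S hpos (fun k => (hblock k).symm ▸ hF k) hrem hcont hup

/-- `BetaAFH β` for the `L₀ⁿ`-construction from the same inputs (no (C), no (U)). [folklore] -/
theorem betaAFH_of_blockTowerWashout_everySlope (S : B12Beta.OneLoopSplit β) {b : ℕ → ℝ} {n : ℕ}
    (hblock : ∀ k, S.β0 k = blockSum n b k) {binf c₀ θ γc : ℝ} {k₁ : ℕ} (hev : EvGeomRate b binf c₀ θ k₁) (hc₀ : 0 ≤ c₀)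
    (hθ0 : 0 ≤ θ) (hθ1 : θ < 1) (hbinf : 0 < binf)
    (hn : k₁ + ⌊(c₀ * θ ^ k₁ / (1 - θ) - min (∑ i ∈ range k₁, b i) ((k₁ : ℝ) * binf)) / binf⌋₊ + 1 ≤ n)
    (hrem : EverySlope S γc) : BetaAFH β := by
  obtain ⟨hpos, hF⟩ := blockSums_washout_of_index_le hev hc₀ hθ0 hθ1 hbinf hn
  exact betaAFH_of_beta0Floor_everySlope S hpos (fun k => (hblock k).symm ▸ hF k) hrem

/-- **LIMIT-FORM ROAD** (`Beta.Assembly.LimitForm` of the `L₀ⁿ`-construction, any threshold scale `k₀`): its one-loop coefficients being block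
sums (`hblock`, one-loop composition) of a small-block sequence with an eventual rate, `0 < β⁰_∞`, at the explicit power ⟹ every sign the CAP could ask is supplied ⟹
`B12.Thm2Printed C L'` (`CapTailSigns.thm2Printed_of_signs`). [cite: Balaban1987RG1, Thm 2 p.259 with (0.31) and (1.22) p.264] -/
theorem thm2Printed_of_blockTowerWashout_limitForm (D : Beta.Assembly.LimitForm β) {C : B12.Construction}
    (hgen : ForwardGenerated C β) {L' : ℝ} (hL : 1 < L') {b : ℕ → ℝ} {n : ℕ} (hblock : ∀ k, D.S.β0 k = blockSum n b k)
    {binf c₀ θ : ℝ} {k₁ : ℕ} (hev : EvGeomRate b binf c₀ θ k₁) (hc₀ : 0 ≤ c₀) (hθ0 : 0 ≤ θ) (hθ1 : θ < 1) (hbinf : 0 < binf)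
    (hn : k₁ + ⌊(c₀ * θ ^ k₁ / (1 - θ) - min (∑ i ∈ range k₁, b i) ((k₁ : ℝ) * binf)) / binf⌋₊ + 1 ≤ n) :
    B12.Thm2Printed C L' := by
  have hpos := blockSums_pos_of_washoutIndex_le hev hc₀ hθ0 hθ1 hbinf hn
  exact CapTailSigns.thm2Printed_of_signs D hgen hL fun k _ => (hblock k).symm ▸ hpos k

/-- **[Balaban1987RG1] THEOREM 2 AS PRINTED FOR THE `L₀ⁿ`-CONSTRUCTION FROM AN EVENTUAL SMALL-BLOCK FLOOR ONLY** (the weakest tower road,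
§4b): forward generation; an eventual floor `0 < f ≤ b_j` (`j ≥ k₁`) of the SMALL-block one-loop coefficients, early ones of any sign; the power
`n ≥ k₁ + ⌊(−min(Σ_{i<k₁} b_i, k₁f))∕f⌋₊ + 1`; the one-loop composition hypothesis `hblock` (Q-asym1-5, a binder); `EverySlope S γc`, (C), (U)
⟹ `B12.Thm2Printed C L'`.  Compare `CapBlockTransferFloors.endpointExistence_of_blockEventualFloor_everySlope` (gen 2): the SAME small-block
input gave END grade at every power; here it gives Theorem-2 grade from an explicit power on. [cite: Balaban1987RG1, Thm 2 p.259 with (0.31) and (1.22) p.264] -/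
theorem thm2Printed_of_blockTowerEventualFloor_everySlope {C : B12.Construction} (hgen : ForwardGenerated C β) {L' : ℝ}
    (hL : 1 < L') (S : B12Beta.OneLoopSplit β) {b : ℕ → ℝ} {n : ℕ} (hblock : ∀ k, S.β0 k = blockSum n b k) {f γc β' : ℝ}
    {k₁ : ℕ} (hf : 0 < f) (hF : ∀ j, k₁ ≤ j → f ≤ b j)
    (hn : k₁ + ⌊(-min (∑ i ∈ range k₁, b i) ((k₁ : ℝ) * f)) / f⌋₊ + 1 ≤ n)
    (hrem : EverySlope S γc) (hcont : BetaContH γc β) (hup : BetaUpperH β' γc β) : B12.Thm2Printed C L' := by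
  obtain ⟨hpos, hFl⟩ := blockSums_of_eventualFloor_index_le hf hF hn
  exact thm2Printed_of_beta0Floor_everySlope hgen hL S hpos (fun k => (hblock k).symm ▸ hFl k) hrem hcont hup

/-- The same on the LIMIT-FORM road of the big construction. [cite: Balaban1987RG1, Thm 2 p.259 with (0.31) and (1.22) p.264] -/
theorem thm2Printed_of_blockTowerEventualFloor_limitForm (D : Beta.Assembly.LimitForm β) {C : B12.Construction}
    (hgen : ForwardGenerated C β) {L' : ℝ} (hL : 1 < L') {b : ℕ → ℝ} {n : ℕ} (hblock : ∀ k, D.S.β0 k = blockSum n b k)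
    {f : ℝ} {k₁ : ℕ} (hf : 0 < f) (hF : ∀ j, k₁ ≤ j → f ≤ b j)
    (hn : k₁ + ⌊(-min (∑ i ∈ range k₁, b i) ((k₁ : ℝ) * f)) / f⌋₊ + 1 ≤ n) : B12.Thm2Printed C L' := by
  obtain ⟨hpos, hFl⟩ := blockSums_of_eventualFloor_index_le hf hF hn
  exact CapTailSigns.thm2Printed_of_signs D hgen hL fun k _ => hpos.trans_le ((hblock k).symm ▸ hFl k)

end

end Summit.QuantumFields.BalabanUV.Gaps.CapBlockTowerWashout
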